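import Literature.NumberTheory.Automorphic.MeanSquareUpperGL2
import HarnessLib

/-!
# Mean square of Whittaker coefficients over a compact set of `GL₂(𝔸_K)` is `L²`-dominated

Topic `NumberTheory/Automorphic`; namespace `Literature.NumberTheory.Automorphic`. A brick of the
local half of the printed proof of Arthur–Clozel (2.3) in rank `2` (named fact
`JacquetShalika1981_partialPairL_pole_of_eq_conj`; Jacquet–Shalika, *Euler products I* (1981), §1,
Prop. (3.17): finiteness at `s = 1` of the bad-place Rankin–Selberg integral). For continuous `F` on
the automorphic quotient of `GL₂`, `φ = invQuot F`, Tate's box `𝓕_N` and character, and a compact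
`C ⊆ GL₂(𝔸_K)` there is `C₀ < ∞`, not depending on `F`, with

  `∫_C ‖W_φ(g)‖² dg ≤ C₀ ‖F‖²_{L²(μ)}`  (`exists_setLIntegral_enorm_sq_whittakerCoeff_le`):

Bessel/Jensen `‖W_φ(g)‖² ≤ ν(𝓕_N)⁻¹ ∫_{𝓕_N} |φ(u g)|²` (`MeanSquareUpperGL2`,
`WhittakerBesselGL2`), Tonelli, the substitution `g ↦ u g`, and domination of orbit integrals over the
compact `closure(𝓕_N) · C` by `μ` (`InvariantMeasureDomination`). This is the `L²(μ)`-continuity of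
`u ↦ W_ũ|_C ∈ L²(C)` through which weak (`L²`) information on translates of a vector controls its
Whittaker coefficients. [folklore]
-/

noncomputable section

open MeasureTheory Measure Set Filter Topology IsDedekindDomain NumberField
open scoped ENNReal Pointwise

namespace Literature.NumberTheory.Automorphic

section CompactMeanSquare

variable {K : Type} [Field K] [NumberField K]

attribute [local instance] adelicBorel borelSpace_adelic glTwoBorel borelSpace_glTwo

variable {μ : Measure (AdelicGroupData.gl 2 K).automorphicQuotient} [(AdelicGroupData.gl 2 K).IsAutomorphicMeasure μ]
  [MeasurableSpace (AdeleRing (𝓞 K) K)] [BorelSpace (AdeleRing (𝓞 K) K)]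
  [MeasurableSpace (adeleQuotient K)] [BorelSpace (adeleQuotient K)]

/-- **Jensen/Bessel at one point**: `‖W_φ(g)‖ₑ² ≤ ν(𝓕_N)⁻¹ ∫⁻_{𝓕_N} ‖φ(u g)‖ₑ²` (the `ξ = 1` term of
`tsum_enorm_sq_whittakerCoeff_le_lintegral`). [folklore] -/
theorem enorm_sq_whittakerCoeff_le_lintegral {F : (AdelicGroupData.gl 2 K).automorphicQuotient → ℂ}
    (hF : Continuous F) (ν : Measure ↥(adelicUnipotent 2 K)) [IsHaarMeasure ν]
    (g : GL (Fin 2) (AdeleRing (𝓞 K) K)) :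
    ‖whittakerCoeff ν (unipotentTateDomain 2 K) (adeleAddChar K)
        (invQuot (AdelicGroupData.gl 2 K) F) g‖ₑ ^ 2 ≤
      (ν (unipotentTateDomain 2 K))⁻¹ *
        ∫⁻ u in unipotentTateDomain 2 K, ‖invQuot (AdelicGroupData.gl 2 K) F
          ((u : GL (Fin 2) (AdeleRing (𝓞 K) K)) * g)‖ₑ ^ 2 ∂ν := by
  refine le_trans ?_ (tsum_enorm_sq_whittakerCoeff_le_lintegral hF ν g)
  have := ENNReal.le_tsum (f := fun ξ : Kˣ => ‖whittakerCoeff ν (unipotentTateDomain 2 K) (adeleAddChar K)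
        (invQuot (AdelicGroupData.gl 2 K) F) (ratDiagGL2 K ξ * g)‖ₑ ^ 2) 1
  simpa only [ratDiagGL2_one, one_mul] using this

/-- **Mean square of Whittaker coefficients over a compact set is `L²`-dominated.** For a compact
`C ⊆ GL₂(𝔸_K)` there is `C₀ < ∞` such that for every continuous `F` on the automorphic quotient,
`∫⁻_{g ∈ C} ‖W_{invQuot F}(g)‖ₑ² dg ≤ C₀ ∫⁻ ‖F‖ₑ² dμ`. [folklore] -/
theorem exists_setLIntegral_enorm_sq_whittakerCoeff_le (ν : Measure ↥(adelicUnipotent 2 K)) [IsHaarMeasure ν]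
    {C : Set (GL (Fin 2) (AdeleRing (𝓞 K) K))} (hC : IsCompact C) :
    ∃ C₀ : ℝ≥0∞, C₀ ≠ ⊤ ∧ ∀ {F : (AdelicGroupData.gl 2 K).automorphicQuotient → ℂ}, Continuous F →
      ∫⁻ g in C, ‖whittakerCoeff ν (unipotentTateDomain 2 K) (adeleAddChar K)
          (invQuot (AdelicGroupData.gl 2 K) F) g‖ₑ ^ 2 ∂(adelicHaar 2 K) ≤
        C₀ * ∫⁻ x, ‖F x‖ₑ ^ 2 ∂μ := by
  obtain ⟨hT2G, hLCG, hSCG⟩ := topology_gl2_adele K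
  haveI : LocallyCompactSpace (AdelicGroupData.gl 2 K).Adelic := hLCG
  haveI : SecondCountableTopology (AdelicGroupData.gl 2 K).Adelic := hSCG
  haveI : T2Space (AdelicGroupData.gl 2 K).Adelic := hT2G
  haveI : MeasurableSMul₂ (AdelicGroupData.gl 2 K).Adelic (AdelicGroupData.gl 2 K).automorphicQuotient :=
    measurableSMul₂_gl_automorphicQuotient 2 K
  set μG : Measure (GL (Fin 2) (AdeleRing (𝓞 K) K)) := adelicHaar 2 K with hμG
  haveI : IsHaarMeasure μG := inferInstanceAs ((adelicHaar 2 K).IsHaarMeasure)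
  set 𝓕 := unipotentTateDomain 2 K with h𝓕def
  have h𝓕0 : ν 𝓕 ≠ 0 := (measure_unipotentTateDomain_pos_of_isHaarMeasure ν).ne'
  have h𝓕top : ν 𝓕 ≠ ⊤ := (measure_unipotentTateDomain_lt_top ν).ne
  have h𝓕c : IsCompact (closure 𝓕) := isCompact_closure_unipotentTateDomain
  -- the compact region `closure(𝓕) · C` and its domination constant
  set N' : Set (GL (Fin 2) (AdeleRing (𝓞 K) K)) :=
    (fun u : ↥(adelicUnipotent 2 K) => (u : GL (Fin 2) (AdeleRing (𝓞 K) K))) '' closure 𝓕 with hN'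
  have hN'c : IsCompact N' := h𝓕c.image continuous_subtype_val
  set D : Set (GL (Fin 2) (AdeleRing (𝓞 K) K)) := N' * C with hD
  have hDc : IsCompact D := hN'c.mul hC
  have hDc' : IsCompact (D : Set (AdelicGroupData.gl 2 K).Adelic) := hDc
  obtain ⟨C₁, hC₁, hdom⟩ := exists_measure_inter_invOrbitPreimage_le (G := (AdelicGroupData.gl 2 K).Adelic)
    μ (adelicHaar 2 K) (isOpenMap_smul_basePoint 2 K) hDc'
  refine ⟨(ν 𝓕)⁻¹ * (ν 𝓕 * C₁), ?_, fun {F} hF => ?_⟩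
  · exact ENNReal.mul_ne_top (ENNReal.inv_ne_top.2 h𝓕0) (ENNReal.mul_ne_top h𝓕top hC₁)
  set φ := invQuot (AdelicGroupData.gl 2 K) F with hφ
  have hφc : Continuous φ := hF.comp ((AdelicGroupData.gl 2 K).continuous_toAutomorphicQuotient.comp
    (continuous_inv : Continuous fun g : (AdelicGroupData.gl 2 K).Adelic => g⁻¹))
  set Φ : GL (Fin 2) (AdeleRing (𝓞 K) K) → ℝ≥0∞ := fun g => ‖φ g‖ₑ ^ 2 with hΦ
  have hΦm : Measurable Φ := hφc.measurable.enorm.pow_const 2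
  -- Step 1: Bessel pointwise, pull out the constant, Tonelli
  calc ∫⁻ g in C, ‖whittakerCoeff ν 𝓕 (adeleAddChar K) φ g‖ₑ ^ 2 ∂μG
      ≤ ∫⁻ g in C, (ν 𝓕)⁻¹ * ∫⁻ u in 𝓕, Φ ((u : GL (Fin 2) (AdeleRing (𝓞 K) K)) * g) ∂ν ∂μG :=
        lintegral_mono fun g => enorm_sq_whittakerCoeff_le_lintegral hF ν g
    _ = (ν 𝓕)⁻¹ * ∫⁻ u in 𝓕, ∫⁻ g in C, Φ ((u : GL (Fin 2) (AdeleRing (𝓞 K) K)) * g) ∂μG ∂ν := by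
        have hunc : Measurable (Function.uncurry fun (g : GL (Fin 2) (AdeleRing (𝓞 K) K))
            (u : ↥(adelicUnipotent 2 K)) => Φ ((u : GL (Fin 2) (AdeleRing (𝓞 K) K)) * g)) :=
          hΦm.comp ((continuous_subtype_val.comp continuous_snd).mul continuous_fst).measurable
        rw [lintegral_const_mul' _ _ (ENNReal.inv_ne_top.2 h𝓕0), lintegral_lintegral_swap hunc.aemeasurable]
    _ ≤ (ν 𝓕)⁻¹ * ∫⁻ u in 𝓕, C₁ * ∫⁻ x, ‖F x‖ₑ ^ 2 ∂μ ∂ν := by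
        gcongr 1
        refine lintegral_mono_ae ?_
        filter_upwards [ae_restrict_mem (measurableSet_unipotentTateDomain (n := 2) (K := K))] with u hu
        -- `∫_C Φ(u g) dg = ∫_{u • C} Φ ≤ ∫_D Φ ≤ C₁ ‖F‖²`
        set uG : GL (Fin 2) (AdeleRing (𝓞 K) K) := (u : GL (Fin 2) (AdeleRing (𝓞 K) K)) with huG
        have hsub : uG • C ⊆ D := by
          rintro _ ⟨c, hc, rfl⟩
          exact Set.mul_mem_mul ⟨u, subset_closure hu, rfl⟩ hc
        have huCm : MeasurableSet (uG • C) := (hC.smul uG).isClosed.measurableSet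
        have hstep : ∫⁻ g in C, Φ (uG * g) ∂μG = ∫⁻ g in uG • C, Φ g ∂μG := by
          rw [← lintegral_indicator hC.isClosed.measurableSet, ← lintegral_indicator huCm]
          conv_rhs => rw [← lintegral_mul_left_eq_self _ uG]
          congr 1 with g
          by_cases hg : g ∈ C
          · rw [Set.indicator_of_mem hg, Set.indicator_of_mem]
            exact ⟨g, hg, rfl⟩
          · rw [Set.indicator_of_notMem hg, Set.indicator_of_notMem]
            rintro ⟨c, hc, hc'⟩
            have hcg : uG * c = uG * g := by simpa [smul_eq_mul] using hc'
            exact hg ((mul_left_cancel hcg) ▸ hc)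
        rw [hstep]
        calc ∫⁻ g in uG • C, Φ g ∂μG ≤ ∫⁻ g in D, Φ g ∂μG := lintegral_mono_set hsub
          _ = ∫⁻ g in (D : Set (AdelicGroupData.gl 2 K).Adelic),
                (fun x => ‖F x‖ₑ ^ 2) (g⁻¹ • basePoint 2 K) ∂(adelicHaar 2 K) := by
              change ∫⁻ g in (D : Set (AdelicGroupData.gl 2 K).Adelic), Φ g ∂(adelicHaar 2 K) = _
              refine setLIntegral_congr_fun hDc'.isClosed.measurableSet fun g _ => ?_
              simp only [hΦ, hφ, invQuot_apply, smul_basePoint]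
          _ ≤ C₁ * ∫⁻ x, ‖F x‖ₑ ^ 2 ∂μ :=
              lintegral_inv_smul_le μ (adelicHaar 2 K) hdom (hF.measurable.enorm.pow_const 2)
    _ = (ν 𝓕)⁻¹ * (ν 𝓕 * C₁) * ∫⁻ x, ‖F x‖ₑ ^ 2 ∂μ := by
        rw [setLIntegral_const]
        ring

end CompactMeanSquare

end Literature.NumberTheory.Automorphic
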